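import Summits.HodgeConjecture.CorCM.Census.HalfParityFloor
import Summits.HodgeConjecture.CorCM.Census.BlockParityBurnside

/-!
# The half-parity law, V: a kernel instance — `G = ℤ/4 × ℤ/2`, `c = (2, 0)`: `t ≥ 1`, so `φ₂ ≥ β − δ` (STRICTLY above the parity floor)

COR-CM (cell `pub-hodgecm2`), count-neutral kernel combinatorics by the binder seat b09 (gen 30; lane HALF-PARITY-LAW), part V:
the smallest Galois CM type on which the coinvariant fibre exceeds the block-parity floor (André-3 PORTFOLIO-g17 §3 row
`Z4xZ2_cinsq`: `β = 3`, `δ = 1`, parity floor `β − 1 − δ = 1`, `fibre₂ = 2`, one NEW half-parity), done CENSUS-FREE in the abstract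
currency with parts I–III: an explicit admissible half-block set `A` (the `H`-halves of all three blocks for the index-two subgroup
`H = 2ℤ/4 × ℤ/2 ∋ c`, every stabiliser lying in `H`; total-parity relation) and ONE face `f` with vanishing block parities and
`hsum A f = 1` give `t(G, c) ≥ 1` (`one_le_halfRank`) and hence **`β ≤ φ₂ + δ`** (`card_block_le_fibreTwo_add_wdelta`) — one more
than gen 28/29's parity floor `β ≤ φ₂ + 1 + δ`, on a named group, by `decide` over `|G| = 8` only (types are explicit `Finset`s;
no enumeration of all types: `sat A` = everything is `|sat A| = 16 = 2^{|G|/2} = #types`, gen 28 `card_CMF`).  Bookkeeping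
definitions (the group elements, `c`, `H`, the nine types, `A`) + theorems; no `Prop`-valued definition, no named fact, no `sorry`.
HONEST FRAMING: `HC_CM` is NOT proved; nothing here is a period or a headline.  The corresponding CM fields are the Galois CM fields
`F` of degree `8` with `Gal(F/ℚ) ≅ ℤ/4 × ℤ/2` and complex conjugation a square (`c ∈ 2G`), e.g. `F = ℚ(ζ₅, √−d)`-type composita are
NOT of this kind (`c ∉ 2G` there); `ℚ(ζ₁₆)⁺(√−…)`-type examples are listed in André-3's atlas (not formalised).
-/

namespace Summit.HodgeConjecture.CorCM.Census.HalfParity.ExampleC4xC2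

open Finset
open Summit.HodgeConjecture.CorCM.Prior.AllgGroup.RfwfAllgGroup
open Summit.HodgeConjecture.CorCM.Census.BlockParity
open Summit.HodgeConjecture.CorCM.Census.Coinvariant

/-- The group `G = ℤ/4 × ℤ/2`, written multiplicatively. [folklore] -/
abbrev G : Type := Multiplicative (ZMod 4 × ZMod 2)

/-- The element `(a, b) ∈ ℤ/4 × ℤ/2`. [folklore] -/
def g (a : ZMod 4) (b : ZMod 2) : G := Multiplicative.ofAdd (a, b)

/-- The involution `c = (2, 0)` (a square: `c ∈ 2G`). [folklore] -/
def c : G := g 2 0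

/-- `c² = 1`. [folklore] -/
theorem c_mul_c : c * c = 1 := by decide

/-- `c ≠ 1`. [folklore] -/
theorem c_ne_one : c ≠ 1 := by decide

/-- The CM-type test is decidable for explicit `Finset`s. [folklore] -/
instance instDecidableIsCMF : DecidablePred (IsCMF c) := fun Φ => by unfold IsCMF; infer_instance

/-- **The index-two subgroup `H = 2ℤ/4 × ℤ/2 = {(0,0), (2,0), (0,1), (2,1)} ∋ c`.** [folklore] -/
def H : Subgroup G where
  carrier := {Q | (Multiplicative.toAdd Q).1 = 0 ∨ (Multiplicative.toAdd Q).1 = 2}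
  mul_mem' := by
    intro a b ha hb
    simp only [Set.mem_setOf_eq] at ha hb ⊢
    revert ha hb; revert a b; decide
  one_mem' := by simp only [Set.mem_setOf_eq]; decide
  inv_mem' := by
    intro a ha
    simp only [Set.mem_setOf_eq] at ha ⊢
    revert ha; revert a; decide

/-- Membership in `H` is decidable. [folklore] -/
instance instDecidableMemH : DecidablePred (· ∈ H) := fun Q => by
  change Decidable ((Multiplicative.toAdd Q).1 = 0 ∨ (Multiplicative.toAdd Q).1 = 2); infer_instance

/-- `c ∈ H`. [folklore] -/
theorem c_mem_H : c ∈ H := by decide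

/-- `H` has index two (`(1, 0) ∉ H` represents the other coset). [folklore] -/
theorem index_H : H.index = 2 :=
  Subgroup.index_eq_two_iff.mpr ⟨g 1 0, by decide⟩

/-- The block representative `{(0,0), (0,1), (1,0), (1,1)}` (stabiliser `⟨(0,1)⟩ ≤ H`); also the first corner of the witness face. [folklore] -/
def T1 : CMF G c := ⟨{g 0 0, g 0 1, g 1 0, g 1 1}, by decide⟩
/-- `T1` flipped at the place of `(0,1)`. [folklore] -/
def T2 : CMF G c := ⟨{g 0 0, g 1 0, g 1 1, g 2 1}, by decide⟩
/-- `T1` flipped at the place of `(0,0)`. [folklore] -/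
def T3 : CMF G c := ⟨{g 0 1, g 1 0, g 1 1, g 2 0}, by decide⟩
/-- `T1` flipped at both places. [folklore] -/
def T4 : CMF G c := ⟨{g 1 0, g 1 1, g 2 0, g 2 1}, by decide⟩
/-- Member of the half-block set `A`. [folklore] -/
def A1 : CMF G c := ⟨{g 0 0, g 0 1, g 1 0, g 3 1}, by decide⟩
/-- Member of the half-block set `A`. [folklore] -/
def A2 : CMF G c := ⟨{g 0 0, g 0 1, g 1 1, g 3 0}, by decide⟩
/-- Member of the half-block set `A`. [folklore] -/
def A3 : CMF G c := ⟨{g 0 0, g 1 0, g 2 1, g 3 1}, by decide⟩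
/-- Member of the half-block set `A`. [folklore] -/
def A4 : CMF G c := ⟨{g 0 1, g 1 1, g 2 0, g 3 0}, by decide⟩
/-- Member of the half-block set `A`. [folklore] -/
def A5 : CMF G c := ⟨{g 1 0, g 2 0, g 2 1, g 3 1}, by decide⟩
/-- Member of the half-block set `A`. [folklore] -/
def A6 : CMF G c := ⟨{g 1 1, g 2 0, g 2 1, g 3 0}, by decide⟩
/-- Member of the half-block set `A`. [folklore] -/
def A7 : CMF G c := ⟨{g 2 0, g 2 1, g 3 0, g 3 1}, by decide⟩

/-- **The half-block set `A`**: the `H`-orbits of one representative of each of the three blocks (`8 = 2 + 4 + 2` types). [folklore] -/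
def A : Finset (CMF G c) := {T1, A1, A2, A3, A4, A5, A6, A7}

/-- `A` is `H`-stable. [folklore] -/
theorem A_stable : ∀ Q ∈ H, ∀ Ψ ∈ A, rt c Q Ψ ∈ A := by decide

/-- `A` is disjoint from its translates along elements outside `H`. [folklore] -/
theorem A_disjoint : ∀ Q ∉ H, ∀ Ψ ∈ A, rt c Q Ψ ∉ A := by decide

/-- `|sat A| = 16`. [folklore] -/
theorem card_sat_A : (sat c A).card = 16 := by decide

/-- **`sat A` is every type** (`16 = 2^{|G|/2}` types in all, gen 28 `card_CMF`). [folklore] -/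
theorem mem_sat_A (Ψ : CMF G c) : Ψ ∈ sat c A := by
  classical
  haveI : Fintype (CMF G c) := Fintype.ofFinite _
  have hcard : (sat c A).card = Fintype.card (CMF G c) := by
    rw [card_sat_A, ← Nat.card_eq_fintype_card, card_CMF c c_mul_c c_ne_one]
    rfl
  rw [Finset.eq_univ_of_card _ hcard]
  exact Finset.mem_univ Ψ

/-- **`A` is admissible** (index-two `H ∋ c`, half-block set, total-parity relation). [folklore] -/
theorem A_mem_admHalves : A ∈ admHalves c c_mul_c :=
  mem_admHalves_of c c_mul_c index_H c_mem_H A_stable A_disjoint (face2_le_ker_hsum_sat_of_forall_mem c mem_sat_A)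

/-- The witness face `f = [T1] + [T4] − [T3] − [T2]` at the places of `(0,0)` and `(0,1)`. [folklore] -/
theorem gface_T1 : gface c c_mul_c T1 (g 0 0) (g 0 1) =
    Finsupp.single T1 1 + Finsupp.single T4 1 - Finsupp.single T3 1 - Finsupp.single T2 1 := by
  have h2 : oflipCM c c_mul_c (g 0 1) T1 = T2 := Subtype.ext (by decide)
  have h3 : oflipCM c c_mul_c (g 0 0) T1 = T3 := Subtype.ext (by decide)
  have h4 : oflipCM c c_mul_c (g 0 0) (oflipCM c c_mul_c (g 0 1) T1) = T4 := by
    rw [h2]; exact Subtype.ext (by decide)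
  unfold gface
  rw [h4, h3, h2]

/-- The places of `(0,0)` and `(0,1)` are distinct. [folklore] -/
theorem g01_notMem_orb : g 0 1 ∉ orb c (g 0 0) := by decide

/-- `T4 = T1·(3,0)⁻¹` and `T3 = T2·(0,1)⁻¹`: the four corners pair up into two blocks. [folklore] -/
theorem T4_eq_rt : T4 = rt c (g 3 0) T1 ∧ T3 = rt c (g 0 1) T2 := ⟨Subtype.ext (by decide), Subtype.ext (by decide)⟩

/-- **The witness has vanishing block parities.** [folklore] -/
theorem par2_witness : par2 c (red c (gface c c_mul_c T1 (g 0 0) (g 0 1))) = 0 := by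
  rw [par2_red, gface_T1, map_sub, map_sub, map_add, par_single, par_single, par_single, par_single, T4_eq_rt.1, T4_eq_rt.2,
    blk_rt, blk_rt]
  have h : ∀ u v : Block c → ZMod 2, u + u - v - v = 0 := fun u v => by
    funext b; simp only [Pi.sub_apply, Pi.add_apply, Pi.zero_apply]; generalize u b = p; generalize v b = q; revert p q; decide
  simp only [one_smul]
  exact h _ _

/-- **… and `hsum A` sees it**: exactly one corner (`T1`) lies in `A`. [folklore] -/
theorem hsum_witness : hsum c A (red c (gface c c_mul_c T1 (g 0 0) (g 0 1))) ≠ 0 := by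
  rw [gface_T1]
  simp only [map_sub, map_add, red_single, hsum_single, Int.cast_one]
  decide

/-- The witness is a Hodge vector mod `2` (a face). [folklore] -/
theorem witness_mem_hodge2 : red c (gface c c_mul_c T1 (g 0 0) (g 0 1)) ∈ hodge2 c c_mul_c :=
  Submodule.mem_sup_left (Submodule.subset_span (red_mem_faces2 c c_mul_c ⟨T1, g 0 0, g 0 1, g01_notMem_orb, rfl⟩))

/-- **`t(ℤ/4 × ℤ/2, (2,0)) ≥ 1`**: the half-parity of `A` is NEW. [folklore] -/
theorem one_le_halfRank : 1 ≤ halfRank c c_mul_c :=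
  one_le_halfRank_of_witness c c_mul_c A_mem_admHalves witness_mem_hodge2 par2_witness hsum_witness

/-- **`β ≤ φ₂ + δ` on `(ℤ/4 × ℤ/2, (2,0))`** — the coinvariant fibre is STRICTLY above the parity floor `β − 1 − δ` here,
census-free (André-3: `β = 3`, `δ = 1`, `φ₂ = 2`). [folklore] -/
theorem card_block_le_fibreTwo_add_wdelta (T₀ : CMF G c) : Fintype.card (Block c) ≤ fibreTwo c c_mul_c + wdelta c T₀ :=
  card_block_le_fibreTwo_add_of_witness c c_mul_c T₀ A_mem_admHalves witness_mem_hodge2 par2_witness hsum_witness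

/-- **Family form**: every family `S` of integer Hodge vectors whose base changes generate the faces modulo pairs has
`|S| + δ ≥ β` on this group (one more than the block-parity law gives). [folklore] -/
theorem card_block_le_card_add_wdelta (T₀ : CMF G c) (S : Finset (CMF G c →₀ ℤ)) (P₀ : Submodule ℤ (CMF G c →₀ ℤ))
    (hP₀ : P₀ ≤ Submodule.span ℤ (pairSet c)) (hS : (S : Set (CMF G c →₀ ℤ)) ⊆ hodgeSpan c c_mul_c)
    (hX : gfaceSet G c c_mul_c ⊆ ↑(P₀ ⊔ Submodule.span ℤ (translates c S))) :
    Fintype.card (Block c) ≤ S.card + wdelta c T₀ := by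
  have h1 := card_block_add_halfRank_le_card_add c c_mul_c (fun x => mul_comm x c) T₀ S P₀ hP₀ hS hX
  have h2 := one_le_halfRank
  omega


/-! ## Appendix (gen 30, same session): `β ≥ 3`, hence `φ₂ ≥ 2` and every generating Hodge family has at least two members -/

/-- The three block representatives `T1`, `A1`, `A3` are pairwise inequivalent under base change. [folklore] -/
theorem blk_ne : blk c T1 ≠ blk c A1 ∧ blk c T1 ≠ blk c A3 ∧ blk c A1 ≠ blk c A3 := by
  refine ⟨fun h => ?_, fun h => ?_, fun h => ?_⟩ <;> obtain ⟨Q, hQ⟩ := exists_rt_eq_of_blk_eq c h <;> revert Q <;> decide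

/-- **`β(ℤ/4 × ℤ/2, (2,0)) ≥ 3`** (three pairwise inequivalent types; André-3: `β = 3`). [folklore] -/
theorem three_le_card_block : 3 ≤ Fintype.card (Block c) := by
  obtain ⟨h1, h2, h3⟩ := blk_ne
  have hcard : ({blk c T1, blk c A1, blk c A3} : Finset (Block c)).card = 3 := by
    rw [Finset.card_insert_of_notMem (by simp [h1, h2]), Finset.card_insert_of_notMem (by simp [h3]),
      Finset.card_singleton]
  exact hcard.symm.le.trans (Finset.card_le_univ _)

/-- **`φ₂(ℤ/4 × ℤ/2, (2,0)) ≥ 2`** — census-free; the block-parity floor alone gives `1`, André-3's `fibre₂ = 2` is attained. [folklore] -/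
theorem two_le_fibreTwo : 2 ≤ fibreTwo c c_mul_c := by
  have h1 := card_block_le_fibreTwo_add_wdelta T1
  have h2 := three_le_card_block
  have h3 := wdelta_le_one c T1
  omega

/-- **Every family of integer Hodge vectors whose base changes generate the faces of `(ℤ/4 × ℤ/2, (2,0))` modulo pairs has at least
TWO members** (`μ ≥ 2`; André-3: `μ = 2`). [folklore] -/
theorem two_le_card (S : Finset (CMF G c →₀ ℤ)) (P₀ : Submodule ℤ (CMF G c →₀ ℤ)) (hP₀ : P₀ ≤ Submodule.span ℤ (pairSet c))
    (hS : (S : Set (CMF G c →₀ ℤ)) ⊆ hodgeSpan c c_mul_c) (hX : gfaceSet G c c_mul_c ⊆ ↑(P₀ ⊔ Submodule.span ℤ (translates c S))) :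
    2 ≤ S.card := by
  have h1 := card_block_le_card_add_wdelta T1 S P₀ hP₀ hS hX
  have h2 := three_le_card_block
  have h3 := wdelta_le_one c T1
  omega

end Summit.HodgeConjecture.CorCM.Census.HalfParity.ExampleC4xC2
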